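import Literature.Probability.LatticeModels.FourFunctionsInfiniteProduct
import Summits.CriticalPhenomena.PercolationContinuityZ3.Theorems.SahiBoxTP2HilbertPositivity

/-!
# Measurable log-supermodular tilts of infinite product measures are box-TP₂
# (cell `prim-sahi`, typer seat, generation 20; `--supports stmt-CriticalPhenomena-4575`)

Theorems only (no definitions, no named facts, no sorries).

Generation 14 (`SahiBoxTP2Tilt*.lean`) proved that box-TP₂ (`IsBoxTP2`: `μ[a,b] μ[a',b'] ≤ μ[a∧a',b∧b'] μ[a∨a',b∨b']`
on closed boxes) is preserved by CONTINUOUS log-supermodular tilts, for an arbitrary box-TP₂ base law.  For PRODUCT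
base laws the four functions theorem on infinite products (Batty–Bollmann 1980, Cor. 3.9; tree
`Literature.Probability.LatticeModels.BattyBollmann.lintegral_four_functions_infinitePi`,
`mIsSetTP2_withDensity_infinitePi`) removes every regularity assumption on the tilt:

* `isBoxTP2_withDensity_infinitePi_of_latticeCondition` — for a COUNTABLE product `μ∞ = ⊗ᵢ μᵢ` of probability
  measures on second-countable order-closed chains `X i` (e.g. `[0,1]`, `ℝ`, `Bool`, `ℤˣ`, `Fin k`, `ℕ`) and ANY
  measurable weight `ρ : (Π i, X i) → [0,∞]` with `ρ(x) ρ(y) ≤ ρ(x ∧ y) ρ(x ∨ y)` at every pair, the Gibbs modification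
  `ρ · μ∞` is box-TP₂.  Special cases: `isBoxTP2_infinitePi_of_linearOrder` (`ρ ≡ 1`: every countable product of
  chain laws is box-TP₂ — generation 14's `isBoxTP2_infinitePi` was the Hilbert cube `ℕ → [0,1]`),
  `isBoxTP2_restrict_sublattice_infinitePi` (`ρ = 1_L`: `μ∞` conditioned on any measurable sublattice `L`).
* On the Hilbert cube `ℕ → [0,1]` the cell's box-TP₂ machine then applies to `ρ · μ∞` (`∫ ρ dμ∞ = 1`):
  `exists_aemonotone_coupling_withDensity_infinitePi` (it is an a.e.-monotone Borel image of Lebesgue measure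
  `λ^ℕ`), `integral_mul_integral_le_withDensity_infinitePi` (FKG for all measurable bounded-below monotone
  functionals), `msahiE_nonneg_withDensity_infinitePi_of_sahiConjecture` (given Sahi's `C_n`, `E_n ≥ 0` for all
  measurable nonnegative monotone families).

HONEST FRAMING (cell rule): nothing here proves `C_n`; the order-`n` statement carries `SahiConjecture n` as a
hypothesis.  The everywhere hypothesis on `ρ` cannot be weakened to almost every pair in infinite volume
(Batty–Bollmann Example 2.3, tree `Literature/Probability/LatticeModels/FourFunctionsAEInfinite.lean`).
-/

noncomputable section

namespace Summit.CriticalPhenomena.PercolationContinuityZ3.Theorems.SahiBoxTP2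

open MeasureTheory Measure Set Function Literature.Combinatorics.Sahi2008
open Literature.Probability.LatticeModels.BattyBollmann Literature.Probability.LatticeModels.Affiliation
open scoped ENNReal unitInterval

/-! ### Countable products of second-countable chains -/

section General

variable {ι : Type*} [Countable ι] {X : ι → Type*} [∀ i, MeasurableSpace (X i)] [∀ i, LinearOrder (X i)]
  [∀ i, TopologicalSpace (X i)] [∀ i, OrderClosedTopology (X i)] [∀ i, SecondCountableTopology (X i)]
  [∀ i, OpensMeasurableSpace (X i)]
  (μ : (i : ι) → Measure (X i)) [∀ i, IsProbabilityMeasure (μ i)]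

/-- **Measurable log-supermodular tilts of a countable product of chain laws are box-TP₂**: for ANY measurable
`ρ : (Π i, X i) → [0,∞]` with `ρ(x) ρ(y) ≤ ρ(x ∧ y) ρ(x ∨ y)` at every pair, `ρ · μ∞` satisfies
`ν[a,b] ν[a',b'] ≤ ν[a ∧ a', b ∧ b'] ν[a ∨ a', b ∨ b']` for all closed boxes (set-TP₂ from Batty–Bollmann's Cor. 3.9,
`mIsSetTP2_withDensity_infinitePi`, restricted to boxes). No continuity, boundedness or integrability of `ρ`.
[this work] -/
theorem isBoxTP2_withDensity_infinitePi_of_latticeCondition (ρ : (Π i, X i) → ℝ≥0∞) (hρ : Measurable ρ)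
    (hMTP : ∀ x y, ρ x * ρ y ≤ ρ (x ⊓ y) * ρ (x ⊔ y)) :
    IsBoxTP2 ((infinitePi μ).withDensity ρ) := fun a b a' b' =>
  (mIsSetTP2_withDensity_infinitePi μ ρ hρ hMTP).icc a b a' b'

/-- **Every countable product of probability measures on second-countable chains is box-TP₂** (`ρ ≡ 1`;
generation 14's `isBoxTP2_infinitePi` is the case `X i = [0,1]`, `isBoxTP2_infinitePi_spinConfig` the case
`X i = ℤˣ`). [this work] -/
theorem isBoxTP2_infinitePi_of_linearOrder : IsBoxTP2 (infinitePi μ) := fun a b a' b' =>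
  (mIsSetTP2_infinitePi μ).icc a b a' b'

/-- **A countable product of chain laws conditioned on a measurable sublattice is box-TP₂**: for `L` measurable,
`⊔`-closed and `⊓`-closed, `μ∞|_L` is box-TP₂ (the tilt by `1_L`, which is log-supermodular exactly because `L` is
a sublattice). [this work] -/
theorem isBoxTP2_restrict_sublattice_infinitePi {L : Set (Π i, X i)} (hL : MeasurableSet L) (hsup : SupClosed L)
    (hinf : InfClosed L) : IsBoxTP2 ((infinitePi μ).restrict L) := by
  rw [← withDensity_indicator_one hL]
  refine isBoxTP2_withDensity_infinitePi_of_latticeCondition μ _ (measurable_one.indicator hL) fun x y => ?_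
  by_cases hx : x ∈ L
  · by_cases hy : y ∈ L
    · rw [indicator_of_mem hx, indicator_of_mem hy, indicator_of_mem (hinf hx hy), indicator_of_mem (hsup hx hy)]
      simp
    · rw [indicator_of_notMem hy, mul_zero]
      exact zero_le
  · rw [indicator_of_notMem hx, zero_mul]
    exact zero_le

end General

/-! ### The Hilbert cube: coupling, FKG, Sahi positivity for measurable tilts of product laws -/

section Hilbert

variable (μ : ℕ → Measure I) [∀ i, IsProbabilityMeasure (μ i)] {ρ : (ℕ → I) → ℝ≥0∞}

omit [∀ i, IsProbabilityMeasure (μ i)] in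
/-- A weight of total mass one defines a probability measure. [folklore] -/
private theorem isProbabilityMeasure_withDensity_of_lintegral (h1 : ∫⁻ x, ρ x ∂infinitePi μ = 1) :
    IsProbabilityMeasure ((infinitePi μ).withDensity ρ) :=
  ⟨by rw [withDensity_apply _ MeasurableSet.univ, Measure.restrict_univ, h1]⟩

/-- **Measurable log-supermodular tilts of a product law on the Hilbert cube are box-TP₂.** [this work] -/
theorem isBoxTP2_withDensity_infinitePi_hilbert (hρ : Measurable ρ)
    (hMTP : ∀ x y, ρ x * ρ y ≤ ρ (x ⊓ y) * ρ (x ⊔ y)) : IsBoxTP2 ((infinitePi μ).withDensity ρ) :=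
  isBoxTP2_withDensity_infinitePi_of_latticeCondition μ ρ hρ hMTP

/-- **Every measurable log-supermodular probability tilt `ρ · μ∞` of a product law on the Hilbert cube is an
a.e.-monotone Borel image of Lebesgue measure `λ^ℕ`** (the cell's coupling theorem for box-TP₂ laws,
`exists_aemonotone_coupling_hilbert`). [this work] -/
theorem exists_aemonotone_coupling_withDensity_infinitePi (hρ : Measurable ρ)
    (hMTP : ∀ x y, ρ x * ρ y ≤ ρ (x ⊓ y) * ρ (x ⊔ y)) (h1 : ∫⁻ x, ρ x ∂infinitePi μ = 1) :
    ∃ G : (ℕ → I) → (ℕ → I), ∃ S : Set (ℕ → I), Measurable G ∧ (∀ᵐ u ∂lebesgueHilbert, u ∈ S) ∧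
      MonotoneOn G S ∧ lebesgueHilbert.map G = (infinitePi μ).withDensity ρ := by
  haveI := isProbabilityMeasure_withDensity_of_lintegral μ h1
  exact exists_aemonotone_coupling_hilbert _ (isBoxTP2_withDensity_infinitePi_hilbert μ hρ hMTP)

/-- **FKG for measurable log-supermodular probability tilts of product laws on the Hilbert cube**: `∫ f ∫ g ≤ ∫ f g`
under `ρ · μ∞` for all measurable nonnegative coordinatewise non-decreasing `f, g` (no continuity of `ρ`, `f`, `g`).
[this work] -/
theorem integral_mul_integral_le_withDensity_infinitePi (hρ : Measurable ρ)
    (hMTP : ∀ x y, ρ x * ρ y ≤ ρ (x ⊓ y) * ρ (x ⊔ y)) (h1 : ∫⁻ x, ρ x ∂infinitePi μ = 1) {f g : (ℕ → I) → ℝ}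
    (hfm : Measurable f) (hgm : Measurable g) (hf0 : ∀ u, 0 ≤ f u) (hg0 : ∀ u, 0 ≤ g u) (hf : Monotone f)
    (hg : Monotone g) :
    (∫ u, f u ∂(infinitePi μ).withDensity ρ) * (∫ u, g u ∂(infinitePi μ).withDensity ρ) ≤
      ∫ u, f u * g u ∂(infinitePi μ).withDensity ρ := by
  haveI := isProbabilityMeasure_withDensity_of_lintegral μ h1
  exact integral_mul_integral_le_of_isBoxTP2_hilbert _ (isBoxTP2_withDensity_infinitePi_hilbert μ hρ hMTP) hfm hgm
    hf0 hg0 hf hg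

/-- **Given Sahi's `C_n`, every measurable log-supermodular probability tilt of a product law on the Hilbert cube is
Sahi-positive of order `n`**: `E_n(f_0,…,f_{n−1}) ≥ 0` for all measurable nonnegative monotone families.
HONEST FRAMING: `SahiConjecture n` is a hypothesis. [this work; cite: Sahi2008, Conj. 5 (p. 212); LiebSahi2021, Conj. 1.1] -/
theorem msahiE_nonneg_withDensity_infinitePi_of_sahiConjecture {n : ℕ} (hC : SahiConjecture n)
    (hρ : Measurable ρ) (hMTP : ∀ x y, ρ x * ρ y ≤ ρ (x ⊓ y) * ρ (x ⊔ y)) (h1 : ∫⁻ x, ρ x ∂infinitePi μ = 1)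
    (f : Fin n → (ℕ → I) → ℝ) (hfm : ∀ i, Measurable (f i)) (hf0 : ∀ i u, 0 ≤ f i u)
    (hmono : ∀ i, Monotone (f i)) : 0 ≤ msahiE ((infinitePi μ).withDensity ρ) n f := by
  haveI := isProbabilityMeasure_withDensity_of_lintegral μ h1
  exact msahiE_nonneg_of_isBoxTP2_hilbert_of_sahiConjecture hC _ (isBoxTP2_withDensity_infinitePi_hilbert μ hρ hMTP)
    f hfm hf0 hmono

/-- Unconditionally for `n ≤ 2` (`C_1, C_2` are theorems). [this work] -/
theorem msahiE_nonneg_withDensity_infinitePi_of_le_two {n : ℕ} (hn : n ≤ 2) (hρ : Measurable ρ)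
    (hMTP : ∀ x y, ρ x * ρ y ≤ ρ (x ⊓ y) * ρ (x ⊔ y)) (h1 : ∫⁻ x, ρ x ∂infinitePi μ = 1)
    (f : Fin n → (ℕ → I) → ℝ) (hfm : ∀ i, Measurable (f i)) (hf0 : ∀ i u, 0 ≤ f i u)
    (hmono : ∀ i, Monotone (f i)) : 0 ≤ msahiE ((infinitePi μ).withDensity ρ) n f := by
  haveI := isProbabilityMeasure_withDensity_of_lintegral μ h1
  exact msahiE_nonneg_of_isBoxTP2_hilbert_of_le_two hn _ (isBoxTP2_withDensity_infinitePi_hilbert μ hρ hMTP)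
    f hfm hf0 hmono

end Hilbert

end Summit.CriticalPhenomena.PercolationContinuityZ3.Theorems.SahiBoxTP2
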